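import Literature.NumberTheory.LFunctions.VinogradovKorobovIntermediateDetector
import Literature.NumberTheory.LFunctions.VinogradovKorobovThreeHalvesLine
import Literature.NumberTheory.LFunctions.VinogradovKorobovIntermediateThreshold
import HarnessLib

/-!
# Theorem 1.4 of Mossinghoff–Trudgian–Yang (threshold `exp 1000`) from Ford's zero-detector lemmas at `η = ½`

Topic `Literature/NumberTheory/LFunctions`. Part of the decomposition of the named fact
`Literature.NumberTheory.LFunctions.zero_free_region_intermediate_mossinghoff_trudgian_yang`
(**Theorem 1.4** of Mossinghoff–Trudgian–Yang, *Res. Number Theory* 10 (2024) = arXiv:2212.06867,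
arXiv numbering throughout: for `|t| ≥ exp 1000` there are no zeros of `ζ(σ + it)` with
`σ > 1 − 0.05035/((27/164) log|t| + 7.096) + 0.0349/((27/164) log|t| + 7.096)²`), whose printed
proof (§6) rests on **Lemma 6.1** (the tree's named fact
`zero_inequality_intermediate_mossinghoff_trudgian_yang`, `VinogradovKorobovInputs.lean`).
Everything declared here is a definition or a PROVED theorem; no named fact is introduced
(D-0026): the analytic inputs of §6 that are not theorems of the tree enter as explicit
hypotheses spelled out with the predicates of `VinogradovKorobovZeroDetector.lean` and
`VinogradovKorobovIntermediateDetector.lean`.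

## What is proved, and how it fits with the sibling files

The tree has: the kernel layer (6.10)–(6.11) (`zero_inequality_intermediate_of_detector`,
`VinogradovKorobovIntermediateInputs.lean`: Lemma 6.1 ⇐ `0 ≤ mtyDetectorRHS θ β t λ`); Ford's
objects and kernel bounds (`VinogradovKorobovZeroDetector.lean`), the kernel facts
(`fordKernelFacts`), Ford's Lemma 3.4 (`FordLogZetaIntegralBound.lean`); the detector core at
`η = ½` **for `t ≥ exp 1000`** (`mtyDetectorRHS_nonneg_of_ford`,
`VinogradovKorobovIntermediateDetector.lean`, from `h42` = MTY Lemma 4.2 in the raw form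
`FordDetectorIneqRaw`, Patel's (3.3), `h91` = (6.4) and the numerical hypothesis
`hΛ : Σ_p Σ_m log p/(p^m(p^m−1)) ≤ 0.851`); the `3/2`-line bound with that constant PROVED
(`VinogradovKorobovThreeHalvesLine.lean`); and the descent Theorem 1.4 ⇐ Lemma 6.1 from the
threshold `exp 1000 − 770000` (`zero_free_region_intermediate_mossinghoff_trudgian_yang_of_from`,
`VinogradovKorobovIntermediateThreshold.lean`: the extremal-zero device of §6 dips below the
starting height, so the printed threshold of Theorem 1.4 needs Lemma 6.1 slightly BELOW
`exp 1000`). This file closes the chain: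

* `fordMangoldtSum_eq_fordLambdaSum`, `fordMangoldtSum_le` — the numerical hypothesis `hΛ` of
  `VinogradovKorobovIntermediateDetector.lean` **discharged** (`Σ ≤ 0.851`, certified in
  `VinogradovKorobovThreeHalvesLine.lean`); hence `zero_inequality_intermediate_of_ford_numerics`:
  Lemma 6.1 from `h42`, Patel's fact and `h91` alone;
* `FordFarZeroSumLT` — the far-zero sum over the STRICT complement `|1+it−ρ| > r` of the near
  disc (see the section below: this is the form a Riemann–von Mangoldt formula bounds, and the
  form the proof of Lemma 4.2 produces), with `FordFarZeroSumLE.lt`;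
* `VK.fordC5_le_of_ge_855` — **`C₅(R) ≤ 1.0117 ≤ 1.0146` for all `R ≥ 855`** on the
  `θ`-interval of `P₄₀` (`H(R) ≤ 50.28`), so that the source's own choice
  `R = 1/(2(1−β)) − 1 ≥ 855` can be followed;
* `zeroInequalityIntermediateFrom_of_detector` — the kernel layer at a variable threshold `T ≥ 1`
  (conclusion `ZeroInequalityIntermediateFrom T`, Lemma 6.1 with `exp 1000` replaced by `T`);
* `mtyDetectorRHS_nonneg_from` — **the detector core (6.8)–(6.9) for every `t ≥ 10⁴`**
  (parametric in the far-sum predicate `Far`, so that it serves both `FordFarZeroSumLE` and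
  `FordFarZeroSumLT`) from `h42` (MTY Lemma 4.2 at `η = ½`, raw form), Patel's fact (through the
  tree's `half_fordLogZetaIntegral_half_le_mtyJ`) and `h92` ((6.4) from a threshold `T₉₂` on),
  with the `3/2`-line bound and the kernel facts taken from the tree; the proof follows §6:
  `R = 1/(2(1−β)) − 1 ≥ 855`, admissibility of `f` with `D = 1.0146λf(0)` at `η = ½`, summation of
  (6.2) against `P₄₀` ((6.3)), the zero-free rectangle and (6.5), (6.7) at the zero itself, the
  cancellation of the `N(jt, ½)` terms;
* `zeroInequalityIntermediateFrom_of_ford` — **Lemma 6.1 from every threshold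
  `T ≥ max(10⁴, T₉₂)`**; `zero_inequality_intermediate_mossinghoff_trudgian_yang_of_ford` — the
  named fact; `zero_free_region_intermediate_mossinghoff_trudgian_yang_of_ford` — **Theorem 1.4
  as printed (threshold `exp 1000`)** from `h42`, Patel's fact and `h92` from `exp 999` on; and
  `zero_free_region_intermediate_mossinghoff_trudgian_yang_of_ford_le` — the same from exactly
  the hypotheses `h42`, `hP`, `h91` of `zero_inequality_intermediate_of_ford`
  (`VinogradovKorobovIntermediateDetector.lean`).

## The remaining hypotheses (status): the trust base is `h42`, `h92` (or `h91`) and Patel's fact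

* `h42` — MTY Lemma 4.2 = Ford 2002, Lemma 4.5 (the mollified explicit formula for `K_f(s)`,
  contour shift to `Re w = −½`, Lemma 3.2, `Σ|ρ|^{-2} ≤ 0.0463`) + Lemma 2.2 (the zero detector via
  the Hadamard product) as in Lemma 4.6, at `η = ½`, in the shape of
  `VinogradovKorobovIntermediateDetector.lean` but with the far-sum predicate a parameter `Far`
  (`FordFarZeroSumLE` as there, or `FordFarZeroSumLT` = what the proof gives).
* `h92`/`h91` — (6.4) = Ford (9.2), from an explicit Riemann–von Mangoldt formula (Rosser's
  Theorem 19 in Ford; (3.8) = Hasanalizade–Shen–Wong in MTY) by the partition of Ford's Lemma 4.3;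
  from a threshold `T₉₂` on — `10⁴` in the source, `exp 999` in the named corollaries (all they
  use; at such heights (9.2) follows from (3.8) with room to spare). With `Far = FordFarZeroSumLT`
  it is what such a formula yields; with `FordFarZeroSumLE` it would fail by `4m(ρ)` for every
  zero exactly on the circle `|1+it−ρ| = ½` (see below).
* `zeta_half_line_patel` — Patel's sub-Weyl bound (3.3), a named fact of the tree.
* Discharged in the tree and used here as theorems: MTY Lemma 4.3 = Ford's Lemma 3.4, the kernel
  facts, the `3/2`-line bound `0.851 b₀` (display after (6.3): "as in the proof of [9, Thm. 3]",
  i.e. Ford's Theorem 3, §9 first display), the kernel layer (6.10)–(6.11).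

## Faithfulness notes

1. Lemma 6.1 is printed for `t ≥ exp 1000`; its proof uses the height only through Lemma 4.2
   (`t ≥ 1000`), Lemma 4.3 (`t ≥ 100`) and (6.4) (`t ≥ 10⁴`), so the assembly yields
   `ZeroInequalityIntermediateFrom T` for every `T ≥ 10⁴` — in particular from
   `exp 1000 − 770000`, which is what the in-tree proof of Theorem 1.4 at the printed threshold
   needs (the extremal-zero device of §6 dips below the starting height; see
   `VinogradovKorobovIntermediateThreshold.lean`).
2. Two slips of the printed §6 are handled as in `VinogradovKorobovIntermediateInputs.lean`,
   note 2: the constant `c` of (6.5) is Ford's `(4/π²)(C₅(R) − 1/R)πλ·…` form (a cube, not a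
   square, in `H(R)/(w(0)(π/2 − π(1−β))³)`), with which `cπ²λf(0) − 4D ≤ 4(C₅(R) − 1/R − 1.0146)
   λf(0) ≤ 0` — this is (6.9); and (6.7) is used with the sign of (6.8)
   (`−Re{…} ≤ −F(1−β) + 0.3334π²f(0)(1−β)`).
3. `J(jt) ≤ J(Kt + 1)` ("`J` is increasing") and `log(jt) ≤ L₁`, `log log(jt) ≤ L₂` are used
   for `1 ≤ j ≤ K = 40`, `t ≥ 10⁴`.

## References

* M. J. Mossinghoff, T. S. Trudgian, A. Yang, *Explicit zero-free regions for the Riemann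
  zeta-function*, Res. Number Theory 10 (2024), no. 11 = arXiv:2212.06867: Lemmas 4.2, 4.3, §6
  ((6.1)–(6.9), Lemma 6.1, proof of Theorem 1.4) (`MossinghoffTrudgianYangRNT2024`).
* K. Ford, *Zero-free regions for the Riemann zeta function*, Number Theory for the Millennium II
  (Urbana, IL, 2000), A K Peters 2002, 25–56 = arXiv:1910.08205: Lemmas 3.4, 4.5, 4.6, §9
  ((9.2) and Lemma 9.2) (`Ford2002Millennium`).
-/

noncomputable section

open Complex Real MeasureTheory Finset Set Filter
open scoped Topology

namespace Literature.NumberTheory.LFunctions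

/-! ## The far-zero sum over the STRICT complement of the near disc

In Ford's Lemma 4.6 / MTY Lemma 4.2 the zeros near `1 + it` (`|1 + it − ρ| ≤ η`, closed disc, as in
`fordNearSum`, `fordN`) keep their `cot` terms and every other zero `ρ` contributes
`|F₀(1 + it − ρ)| ≤ D|1 + it − ρ|^{-2}`: each zero enters exactly once, so the far sum produced by
the proof ranges over `|1 + it − ρ| > η`. The printed (4.8) writes `Σ_{|s−ρ| ≥ η}` (a zero on the
circle `|s − ρ| = η` would be counted twice, which only weakens (4.8)), but the far-zero BOUNDS
that are fed into it — (6.4) = Ford (9.2), MTY Lemma 4.6, Ford Lemma 4.3: "`N₂ + N₃ = N(t+1) −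
N(t−1) − N(t, v)`" — subtract the closed-disc count `N(t, η)` and are therefore bounds for the sum
over `|1 + it − ρ| > η` (they are what a Riemann–von Mangoldt formula gives; with `≥` they would
fail by `4m(ρ)` for every zero on the circle). We therefore state both the detector hypothesis
`h42` and the far-zero hypothesis `h92` below with the strict far sum `FordFarZeroSumLT`; since
`FordFarZeroSumLE t r S → FordFarZeroSumLT t r S`, the strict form of `h42` implies the form with
the tree's `FordFarZeroSumLE` (as in `zero_inequality_mossinghoff_trudgian_yang_of_ford`, whose
`h46` has the same feature). -/

/-- "`Σ_{|1+it−ρ| > r} m(ρ)/|1 + it − ρ|² ≤ S`" over the non-trivial zeros strictly outside the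
disc of radius `r` about `1 + it` (every finite partial sum is `≤ S`); compare `FordFarZeroSumLE`
(`≥ r`). [cite: Ford2002Millennium, Lemma 4.6 (proof) and Lemma 4.3] -/
def FordFarZeroSumLT (t r S : ℝ) : Prop :=
  ∀ T : Finset ℂ, (∀ ρ ∈ T, riemannZeta ρ = 0 ∧ 0 < ρ.re ∧ ρ.re < 1 ∧ r < ‖1 + t * I - ρ‖) →
    ∑ ρ ∈ T, (riemannZetaZeroOrder ρ : ℝ) / ‖1 + t * I - ρ‖ ^ 2 ≤ S

/-- A bound for the far sum over `|1+it−ρ| ≥ r` bounds the far sum over `|1+it−ρ| > r`. [folklore] -/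
theorem FordFarZeroSumLE.lt {t r S : ℝ} (h : FordFarZeroSumLE t r S) : FordFarZeroSumLT t r S :=
  fun T hT ↦ h T fun ρ hρ ↦
    ⟨(hT ρ hρ).1, (hT ρ hρ).2.1, (hT ρ hρ).2.2.1, (hT ρ hρ).2.2.2.le⟩

/-- `FordFarZeroSumLT` is monotone in the bound. [folklore] -/
theorem FordFarZeroSumLT.mono {t r S S' : ℝ} (h : FordFarZeroSumLT t r S) (hS : S ≤ S') :
    FordFarZeroSumLT t r S' :=
  fun T hT ↦ (h T hT).trans hS

/-! ## `C₅(R) ≤ 1.0146` for `R ≥ 855` (MTY §6: "we have `C₅(R) ≤ 1.0146`") -/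

namespace VK

/-- `(R+1)²/R³ ≤ 856²/855³` for `R ≥ 855` (`(R+1)²/R³ = R⁻¹(1 + R⁻¹)²` decreases). [folklore] -/
theorem ratio_le_of_ge_855 {R : ℝ} (hR : 855 ≤ R) : (R + 1) ^ 2 / R ^ 3 ≤ 856 ^ 2 / 855 ^ 3 := by
  have hR0 : 0 < R := by linarith
  have e : (R + 1) ^ 2 / R ^ 3 = (1 / R) * (1 + 1 / R) ^ 2 := by field_simp
  have hv : 1 / R ≤ 1 / 855 := one_div_le_one_div_of_le (by norm_num) hR
  rw [e]
  calc (1 / R) * (1 + 1 / R) ^ 2 ≤ (1 / 855) * (1 + 1 / 855) ^ 2 :=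
        mul_le_mul hv (pow_le_pow_left₀ (by positivity) (by linarith) 2) (by positivity) (by norm_num)
    _ = 856 ^ 2 / 855 ^ 3 := by norm_num

/-- **`H(R) ≤ 50.28` for `R ≥ 855`** on the `θ`-interval of `P₄₀` (true `H(855) = 50.27…`; the
source quotes `H(R) ≤ 134.87`, any such bound being used only through `C₅(R) ≤ 1.0146`).
[cite: MossinghoffTrudgianYangRNT2024, §6 (proof of Lemma 6.1: R ≥ 855)] -/
theorem fordH_le_of_ge_855 {θ : ℝ} (h1 : 1.13331020 ≤ θ) (h2 : θ ≤ 1.13331021) {R : ℝ}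
    (hR : 855 ≤ R) : fordH θ R ≤ 50.28 := by
  obtain ⟨hs1, hs2⟩ := sin_mem_of_mem_thetaIcc h1 h2
  obtain ⟨hc1, hc2⟩ := cos_mem_of_mem_thetaIcc h1 h2
  have hR0 : 0 < R := by linarith
  have hc0 : 0 < Real.cos θ := by linarith
  have hs0 : 0 < Real.sin θ := by linarith
  have hθ0 : 0 < θ := by linarith
  have htan0 : 0 ≤ Real.tan θ := by rw [Real.tan_eq_sin_div_cos]; positivity
  have htan : Real.tan θ ≤ 2.1380629 := by
    rw [Real.tan_eq_sin_div_cos, div_le_iff₀ hc0]; nlinarith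
  have hT2 : Real.tan θ ^ 2 ≤ 2.1380629 ^ 2 := pow_le_pow_left₀ htan0 htan 2
  have hT3 : Real.tan θ ^ 3 ≤ 2.1380629 ^ 3 := pow_le_pow_left₀ htan0 htan 3
  have hT4 : Real.tan θ ^ 4 ≤ 2.1380629 ^ 4 := pow_le_pow_left₀ htan0 htan 4
  -- c₀
  have hC0 : fordC₀ θ ≤ 14.517593 := by
    unfold fordC₀
    rw [div_le_iff₀ (by positivity)]
    have : (0.4236636815659 : ℝ) ^ 3 ≤ Real.cos θ ^ 3 := pow_le_pow_left₀ (by norm_num) hc1 3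
    nlinarith
  have hC0' : 0 ≤ fordC₀ θ := by unfold fordC₀; positivity
  -- θ − sin θ cos θ
  have hd1 : θ - Real.sin θ * Real.cos θ ≤ 0.74954736 := by nlinarith
  have hd0 : 0 ≤ θ - Real.sin θ * Real.cos θ := by nlinarith
  have hC1 : fordC₁ θ ≤ 15.663218 := by
    unfold fordC₁
    calc (θ - Real.sin θ * Real.cos θ) * Real.tan θ ^ 4 ≤ 0.74954736 * 2.1380629 ^ 4 :=
          mul_le_mul hd1 hT4 (by positivity) (by norm_num)
      _ ≤ _ := by norm_num
  have hC1' : 0 ≤ fordC₁ θ := by unfold fordC₁; positivity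
  have hC2 : fordC₂ θ ≤ 8.019455 := by
    unfold fordC₂
    have : Real.sin θ ^ 2 ≤ 0.9058195653231 ^ 2 := pow_le_pow_left₀ hs0.le hs2 2
    calc Real.tan θ ^ 3 * Real.sin θ ^ 2 ≤ 2.1380629 ^ 3 * 0.9058195653231 ^ 2 :=
          mul_le_mul hT3 this (by positivity) (by norm_num)
      _ ≤ _ := by norm_num
  have hC2' : 0 ≤ fordC₂ θ := by unfold fordC₂; positivity
  have hC3 : fordC₃ θ ≤ 3.4264156 := by
    unfold fordC₃
    calc (θ - Real.sin θ * Real.cos θ) * Real.tan θ ^ 2 ≤ 0.74954736 * 2.1380629 ^ 2 :=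
          mul_le_mul hd1 hT2 (by positivity) (by norm_num)
      _ ≤ _ := by norm_num
  have hC3' : 0 ≤ fordC₃ θ := by unfold fordC₃; positivity
  -- exp (2 θ cot θ)
  have hcot : Real.cot θ ≤ 0.4236636906242 / 0.9058195610863 := by
    rw [Real.cot_eq_cos_div_sin, div_le_div_iff₀ hs0 (by norm_num)]; nlinarith
  have hcot0 : 0 ≤ Real.cot θ := by rw [Real.cot_eq_cos_div_sin]; positivity
  have harg : 2 * θ * Real.cot θ ≤ (1 : ℕ) + 0.0601282 := by
    calc 2 * θ * Real.cot θ ≤ 2 * 1.13331021 * (0.4236636906242 / 0.9058195610863) :=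
          mul_le_mul (by linarith) hcot hcot0 (by norm_num)
      _ ≤ _ := by norm_num
  have hexp : Real.exp (2 * θ * Real.cot θ) ≤ 2.88675 :=
    (Real.exp_le_exp.2 harg).trans
      (exp_le_of_expUB_le (k := 1) (f := 0.0601282) (by norm_num) (by norm_num) (by norm_num [expUB]))
  -- the `R`-dependent pieces
  have hratio := ratio_le_of_ge_855 hR
  have hratio0 : 0 ≤ (R + 1) ^ 2 / R ^ 3 := by positivity
  have hR2 : 1 / R ^ 2 ≤ 1 / 855 ^ 2 := by
    apply one_div_le_one_div_of_le (by norm_num)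
    nlinarith
  -- the bracket
  have hB : fordC₂ θ * ((R + 1) ^ 2 / R ^ 3) * (Real.exp (2 * θ * Real.cot θ) + 1)
      + fordC₁ θ / R ^ 2 + fordC₃ θ
      ≤ 8.019455 * (856 ^ 2 / 855 ^ 3) * (2.88675 + 1) + 15.663218 * (1 / 855 ^ 2) + 3.4264156 := by
    have e1 : fordC₂ θ * ((R + 1) ^ 2 / R ^ 3) * (Real.exp (2 * θ * Real.cot θ) + 1)
        ≤ 8.019455 * (856 ^ 2 / 855 ^ 3) * (2.88675 + 1) :=
      mul_le_mul (mul_le_mul hC2 hratio hratio0 (by norm_num)) (by linarith) (by positivity)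
        (by positivity)
    have e2 : fordC₁ θ / R ^ 2 ≤ 15.663218 * (1 / 855 ^ 2) := by
      rw [div_eq_mul_one_div]
      exact mul_le_mul hC1 hR2 (by positivity) (by norm_num)
    linarith
  have hB0 : 0 ≤ fordC₂ θ * ((R + 1) ^ 2 / R ^ 3) * (Real.exp (2 * θ * Real.cot θ) + 1)
      + fordC₁ θ / R ^ 2 + fordC₃ θ := by positivity
  -- the denominator
  have hD0 : (0 : ℝ) < 1 - 2.1380629 ^ 2 * (1 / 855 ^ 2) := by norm_num
  have hD : (1 - 2.1380629 ^ 2 * (1 / 855 ^ 2) : ℝ) ^ 2 ≤ (1 - Real.tan θ ^ 2 / R ^ 2) ^ 2 := by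
    apply pow_le_pow_left₀ hD0.le
    have : Real.tan θ ^ 2 / R ^ 2 ≤ 2.1380629 ^ 2 * (1 / 855 ^ 2) := by
      rw [div_eq_mul_one_div]
      exact mul_le_mul hT2 hR2 (by positivity) (by norm_num)
    linarith
  have hfrac : fordC₀ θ / (1 - Real.tan θ ^ 2 / R ^ 2) ^ 2
      ≤ 14.517593 / (1 - 2.1380629 ^ 2 * (1 / 855 ^ 2)) ^ 2 :=
    div_le_div₀ (by norm_num) hC0 (pow_pos hD0 2) hD
  unfold fordH
  calc _ ≤ 14.517593 / (1 - 2.1380629 ^ 2 * (1 / 855 ^ 2)) ^ 2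
        * (8.019455 * (856 ^ 2 / 855 ^ 3) * (2.88675 + 1) + 15.663218 * (1 / 855 ^ 2)
          + 3.4264156) := mul_le_mul hfrac hB hB0 (by positivity)
    _ ≤ 50.28 := by norm_num

/-- `H(R) ≥ 0` for `R ≥ 855` on the `θ`-interval. [folklore] -/
theorem fordH_nonneg_of_ge_855 {θ : ℝ} (h1 : 1.13331020 ≤ θ) (h2 : θ ≤ 1.13331021) {R : ℝ}
    (hR : 855 ≤ R) : 0 ≤ fordH θ R :=
  fordH_nonneg_of_pos (by linarith) (by linarith [Real.pi_gt_d6]) (by linarith)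

/-- **`C₅(R) ≤ 1.0117 ≤ 1.0146` for `R ≥ 855`** on the `θ`-interval of `P₄₀` (MTY §6: "with
`C₅(R)` as defined in (4.7), we have `C₅(R) ≤ 1.0146`"; true `C₅(855) = 1.0116…`).
[cite: MossinghoffTrudgianYangRNT2024, §6 (proof of Lemma 6.1)] -/
theorem fordC5_le_of_ge_855 {θ : ℝ} (h1 : 1.13331020 ≤ θ) (h2 : θ ≤ 1.13331021) {R : ℝ}
    (hR : 855 ≤ R) : fordC5 θ R ≤ 1.0117 := by
  have hH := fordH_le_of_ge_855 h1 h2 hR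
  have hH0 := fordH_nonneg_of_ge_855 h1 h2 hR
  have hw := fordSmoothW0_ge h1 h2
  have hR0 : 0 < R := by linarith
  have hratio := ratio_le_of_ge_855 hR
  have hRinv : 1 / R ≤ 1 / 855 := one_div_le_one_div_of_le (by norm_num) hR
  unfold fordC5
  have e : fordH θ R * (R + 1) ^ 2 / (R ^ 3 * fordSmoothW0 θ)
      = fordH θ R * ((R + 1) ^ 2 / R ^ 3) / fordSmoothW0 θ := by
    field_simp
  have h1' : fordH θ R * ((R + 1) ^ 2 / R ^ 3) / fordSmoothW0 θ
      ≤ 50.28 * (856 ^ 2 / 855 ^ 3) / 5.6453 :=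
    div_le_div₀ (by norm_num) (mul_le_mul hH hratio (by positivity) (by norm_num)) (by norm_num) hw
  rw [e]
  calc _ ≤ 50.28 * (856 ^ 2 / 855 ^ 3) / 5.6453 + 1 + 1 / (855 : ℝ) := by linarith
    _ ≤ _ := by norm_num

end VK


/-! ## Lemma 6.1 from the detector inequality, at a variable threshold

The tree's `zero_inequality_intermediate_of_detector` (`VinogradovKorobovIntermediateInputs.lean`)
derives Lemma 6.1 — for `t ≥ exp 1000` — from the detector inequality (6.8)–(6.9)
(`0 ≤ mtyDetectorRHS θ β t λ`); the same kernel-layer argument at any threshold `T ≥ 1` gives the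
predicate `ZeroInequalityIntermediateFrom T` of `VinogradovKorobovIntermediateThreshold.lean`
(Lemma 6.1 with `exp 1000` replaced by `T`), which is what Theorem 1.4 as printed consumes
(`zero_free_region_intermediate_mossinghoff_trudgian_yang_of_from`, at `T = exp 1000 − 770000`). -/

/-- **Lemma 6.1 from threshold `T`, from its zero-detector core from threshold `T`** (the proof of
`zero_inequality_intermediate_of_detector` verbatim; the threshold enters only through `t > 0`).
[cite: MossinghoffTrudgianYangRNT2024, Lemma 6.1 (proof: (6.8)–(6.11))] -/
theorem zeroInequalityIntermediateFrom_of_detector {θ : ℝ}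
    (hθ : IsFordTheta (mtyB40 0) (mtyB40 1) θ) (hθ1 : 1.13331020 ≤ θ) (hθ2 : θ ≤ 1.13331021)
    {T : ℝ} (hT : 1 ≤ T)
    (hZ : ∀ β t : ℝ, T ≤ t → riemannZeta (β + t * I) = 0 → 1 - 1 / 1712 ≤ β →
      ∀ lam : ℝ, 0 < lam → lam ≤ 1 - β → ZetaZeroFreeRect lam t (40 * t + 1) →
        0 ≤ mtyDetectorRHS θ β t lam) :
    ZeroInequalityIntermediateFrom T := by
  intro β t ht hz hβ lam hl0 hl1 hrect
  have h0 := hZ β t ht hz hβ lam hl0 hl1 hrect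
  obtain ⟨hθ0, hθpi, heq⟩ := hθ
  -- certified numerics on the θ-interval
  have hw : 5.6453 ≤ fordSmoothW0 θ := VK.fordSmoothW0_ge hθ1 hθ2
  have hcos : 0.17949 ≤ Real.cos θ ^ 2 := VK.cos_sq_ge_of_mem_thetaIcc hθ1 hθ2
  have hratio := VK.wDeriv_ratio_mtyB40_le hθ1 hθ2
  have hWd := VK.fordLaplaceWDeriv0_mem hθ1 hθ2
  have hb1nn : 0 ≤ mtyB40 1 := isNonnegTrigPoly_mtyB40.1 1
  have h5746 := coeff_5746_mtyB40
  -- kernel facts (all proved in `VinogradovKorobovIntermediateInputs.lean`)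
  have hid := ford_W_identity ⟨hθ0, hθpi, heq⟩ (by rw [mtyB40_zero]; norm_num)
  have hconv := fordLaplaceW_zero_sub_le hθ0 hθpi ((1 - β) / lam - 1)
  rw [fordKernelMoment_eq hθ0 hθpi] at hconv
  have hw0 : fordKernelW θ 0 = fordSmoothW0 θ := fordKernelW_zero hθ0 hθpi
  -- elementary signs
  have ht0 : 0 < t := by linarith
  have hL1 : 0 ≤ Real.log (40 * t + 1) := Real.log_nonneg (by linarith)
  have hX0 : 0 ≤ (1 - β) / lam - 1 := by
    rw [sub_nonneg, le_div_iff₀ hl0]; linarith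
  have hβ1 : 0 ≤ 1 - β := by linarith
  have htail := detector_tail_le (L₂ := Real.log (Real.log (40 * t + 1))) hL1
  -- normalise `b₀ = 1`, `w(0)`, `|W'(0)|`
  unfold mtyDetectorRHS at h0
  rw [hw0, mtyB40_zero] at h0
  rw [mtyB40_zero] at hid hratio
  rw [abs_of_nonpos hWd.2, mul_one] at hratio
  rw [mtyB40_zero, div_one]
  have hw0pos : 0 < fordSmoothW0 θ := by linarith
  have hmb : -fordLaplaceWDeriv0 θ * mtyB40 1 ≤ 0.20466 * fordSmoothW0 θ := by
    rwa [div_le_iff₀ hw0pos] at hratio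
  -- make the kernel quantities atoms
  generalize fordLaplaceW θ 0 = W0 at hid hconv
  generalize fordLaplaceW θ ((1 - β) / lam - 1) = WX at h0 hconv
  generalize fordLaplaceW θ (-1) = Wm at h0 hid
  generalize fordSmoothW0 θ = w0 at h0 hid hw hmb hw0pos
  generalize -fordLaplaceWDeriv0 θ = m at hconv hmb
  generalize Real.cos θ ^ 2 = c2 at hid hcos
  generalize (1 - β) / lam - 1 = X at h0 hconv hX0 ⊢
  generalize Real.log (40 * t + 1) = L₁ at h0 hL1 htail ⊢
  generalize Real.log L₁ = L₂ at h0 htail ⊢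
  generalize mtyJ (40 * t + 1) = J at h0 ⊢
  generalize mtyB40 1 = b₁ at h0 hid hb1nn h5746 hmb
  generalize mtyB40Sum = b at h0 htail ⊢
  have h1 := mul_le_mul_of_nonneg_left hconv hb1nn
  have hkey : w0 * c2 - b₁ * (X * m) ≤ lam * w0 * (0.3334 * π ^ 2 * b₁ * (1 - β) + b * J + 0.851
      + 1.0146 * lam * (b * (1.8 + L₁ / 3 + 3.2357 * L₁ + 5.316 * L₂ + 16.134) + 1.8 * 1)) := by
    linarith
  have h2 : X * (m * b₁) ≤ X * (0.20466 * w0) := mul_le_mul_of_nonneg_left hmb hX0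
  have h4 : c2 - 0.20466 * X - lam * (0.3334 * π ^ 2 * b₁ * (1 - β) + b * J + 0.851
      + 1.0146 * lam * (b * (1.8 + L₁ / 3 + 3.2357 * L₁ + 5.316 * L₂ + 16.134) + 1.8 * 1)) ≤ 0 := by
    by_contra hcon
    push Not at hcon
    nlinarith [mul_pos hw0pos hcon]
  have hS : 0.3334 * π ^ 2 * b₁ * (1 - β) + b * J + 0.851
      + 1.0146 * lam * (b * (1.8 + L₁ / 3 + 3.2357 * L₁ + 5.316 * L₂ + 16.134) + 1.8 * 1)
      ≤ 5.746 * (1 - β) + b * J + 0.851 + 1.0146 * lam * b * (3.5691 * L₁ + 5.316 * L₂ + 18.439) := by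
    have e1 : 0.3334 * π ^ 2 * b₁ * (1 - β) ≤ 5.746 * (1 - β) :=
      mul_le_mul_of_nonneg_right h5746 hβ1
    have e2 : 1.0146 * lam * (b * (1.8 + L₁ / 3 + 3.2357 * L₁ + 5.316 * L₂ + 16.134) + 1.8 * 1)
        ≤ 1.0146 * lam * (b * (3.5691 * L₁ + 5.316 * L₂ + 18.439)) :=
      mul_le_mul_of_nonneg_left htail (by positivity)
    linarith
  have hS' := mul_le_mul_of_nonneg_left hS hl0.le
  rw [one_div, inv_mul_le_iff₀ hl0]
  linarith

/-! ## The assembly at `η = ½` (MTY §6, (6.2)–(6.9); Ford 2002, §9) -/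

/-- One step of the summation over `j` in (6.3): from the raw detector inequality (6.2) at height
`(j+1)t` with the far-zero sum bounded by (6.4), replace `½∫_{σ=½} ≤ J((j+1)t) ≤ J(Kt+1)`,
`log((j+1)t) ≤ L₁`, `log log((j+1)t) ≤ L₂`, and multiply by `b_{j+1} ≥ 0`.
[cite: MossinghoffTrudgianYangRNT2024, §6, (6.2)–(6.4)] -/
theorem detector_step_half {K NS Im Ip N Lg LL L₁ L₂ J JT f0 D b : ℝ}
    (hf0 : 0 ≤ f0) (hD : 0 ≤ D) (hb : 0 ≤ b) (hLg : Lg ≤ L₁) (hLL : LL ≤ L₂)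
    (hIm : 1 / 2 * Im ≤ J) (hJ : J ≤ JT)
    (h : K ≤ -NS + f0 / 2 * (Im - Ip)
      + D * (1.8 + Lg / 3 + (3.2357 * Lg + 5.316 * LL + 16.134 - 4 * N))) :
    b * K ≤ b * (f0 * JT + D * (1.8 + L₁ / 3 + 3.2357 * L₁ + 5.316 * L₂ + 16.134))
      - b * NS - f0 / 2 * (b * Ip) - 4 * D * (b * N) := by
  have h1 : f0 / 2 * Im ≤ f0 * JT := by
    have := mul_le_mul_of_nonneg_left (hIm.trans hJ) hf0
    linarith
  have h2 : D * Lg ≤ D * L₁ := mul_le_mul_of_nonneg_left hLg hD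
  have h3 : D * LL ≤ D * L₂ := mul_le_mul_of_nonneg_left hLL hD
  have h4 : K ≤ -NS + f0 * JT - f0 / 2 * Ip
      + D * (1.8 + L₁ / 3 + 3.2357 * L₁ + 5.316 * L₂ + 16.134) - 4 * D * N := by
    linarith
  have h5 := mul_le_mul_of_nonneg_left h4 hb
  have e : b * (-NS + f0 * JT - f0 / 2 * Ip
      + D * (1.8 + L₁ / 3 + 3.2357 * L₁ + 5.316 * L₂ + 16.134) - 4 * D * N)
      = b * (f0 * JT + D * (1.8 + L₁ / 3 + 3.2357 * L₁ + 5.316 * L₂ + 16.134))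
        - b * NS - f0 / 2 * (b * Ip) - 4 * D * (b * N) := by ring
  linarith

/-- The final, purely linear step of the derivation of (6.8) (with the sum over `N(jt, ½)` already
dropped by (6.9)): positivity (6.1)/(6.3), `K(1) ≤ F(0) + 1.8D`, the summed detector inequalities,
the `3/2`-line bound `0.851 b₀`, the near-zero bounds (6.5)–(6.7) with `c₅c²w(0) ≤ 4D`.
[cite: MossinghoffTrudgianYangRNT2024, §6, (6.3)–(6.9)] -/
theorem assembly_half_final {lam β w0 f0 D b₁ bS K1 SK SNS SI SN V0 bd WXv Wm1v L₁ L₂ JT : ℝ}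
    (hf0 : f0 = lam * w0) (hD : D = 1.0146 * lam * f0) (hb1 : 0 ≤ b₁) (hf0nn : 0 ≤ f0)
    (hpos : 0 ≤ 1 * K1 + SK) (hK1 : K1 ≤ Wm1v + 1.8 * D)
    (hSK : SK ≤ bS * (f0 * JT + D * (1.8 + L₁ / 3 + 3.2357 * L₁ + 5.316 * L₂ + 16.134))
        - SNS - f0 / 2 * SI - 4 * D * SN)
    (hSI : -(2 * 0.851) * 1 ≤ SI) (hSNS : -SNS ≤ -(b₁ * V0) + bd * SN) (hbd : bd ≤ 4 * D)
    (hSN : 0 ≤ SN) (hV0 : -(0.3334 * π ^ 2 * f0 * (1 - β)) + WXv ≤ V0) :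
    0 ≤ -b₁ * (WXv - 0.3334 * π ^ 2 * (lam * w0) * (1 - β))
      + lam * w0 * (bS * JT + 0.851 * 1) + 1 * Wm1v
      + 1.0146 * lam * (lam * w0)
          * (bS * (1.8 + L₁ / 3 + 3.2357 * L₁ + 5.316 * L₂ + 16.134) + 1.8 * 1) := by
  have h1 : -(f0 / 2 * SI) ≤ 0.851 * f0 := by
    have := mul_le_mul_of_nonneg_left hSI (by positivity : 0 ≤ f0 / 2)
    linarith
  have h2 : bd * SN ≤ 4 * D * SN := mul_le_mul_of_nonneg_right hbd hSN
  have h3 : b₁ * (-(0.3334 * π ^ 2 * f0 * (1 - β)) + WXv) ≤ b₁ * V0 :=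
    mul_le_mul_of_nonneg_left hV0 hb1
  subst hD hf0
  linarith

/-- **The zero-detector core (6.8)–(6.9) of Lemma 6.1 of Mossinghoff–Trudgian–Yang, from Ford's
lemmas at `η = ½`.** For a solution `θ ∈ [1.13331020, 1.13331021]` of (4.1) for `P₄₀`, a zero
`β + it` with `t ≥ 10⁴`, `β ≥ 1 − 1/1712`, and `λ ∈ (0, 1 − β]` with the rectangle
`1 − λ < Re s ≤ 1`, `t − 1 ≤ Im s ≤ 40t + 1` free of zeros, the inequality
`0 ≤ mtyDetectorRHS θ β t λ` ((6.8) with its `N(jt, ½)`-sum dropped) follows from: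

* `h42` — **MTY Lemma 4.2** (Ford 2002, Lemmas 4.5–4.6) at `η = ½`, the raw smoothed zero
  detector (4.8), for an admissible smoothing `f` (`IsFordSmoothing f ½ D`), `t ≥ 1000` and any
  bound `S` of the far-zero sum in the sense of the predicate `Far` (`FordDetectorIneqRaw`),
  together with `K(1) ≤ F(0) + 1.8D`;
* `hP` — Patel's (3.3), giving `½∫ log|ζ(½ + i(t + u/π))|/cosh²u du ≤ J(t)` (`t ≥ 100`) through
  the tree's `half_fordLogZetaIntegral_half_le_mtyJ` (MTY Lemma 4.3);
* `h92` — the far-zero bound **(6.4)** (Ford 2002, (9.2)) from a threshold `T₉₂` on (the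
  source: `t ≥ 10⁴`), for the far sum in the sense of `Far`:
  `Σ_{far} |1+it−ρ|^{-2} ≤ 3.2357 log t + 5.316 log log t + 16.134 − 4N(t, ½)`.

The `3/2`-line bound `−½ Σ_{j=1}^{K} b_j ∫ log|ζ(3/2 + ijt₁ + iu/π)|/cosh²u du ≤ 0.851 b₀`
(display after (6.3)) is the tree's `mty_threeHalves_line_bound_mtyB40`, and the kernel facts
`FordKernelFacts θ` the tree's `fordKernelFacts`. Proved here, following §6 line by line: `R = 1/(2(1−β)) − 1 ≥ 855`, `C₅(R) ≤ 1.0146`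
(`VK.fordC5_le_of_ge_855`), hence `|F₀(z)| ≤ 1.0146λf(0)/|z|²` for `Re z ≥ 0`,
`|z| ≥ (R+1)λ` (in particular `|z| ≥ ½`; `norm_fordLaplace_fordSmoothF_sub_le`), so `f` is
admissible with `D = 1.0146λf(0)`, `η = ½`; positivity (6.1)/(6.3) (`fordK_trigPoly_nonneg'`);
the zero-free rectangle gives `Re z_ρ ≥ πλ` for the zeros near `1 + ijt`, so (6.5) holds by
Ford's maximum-modulus bound (`re_fordV_ge`, with the corrected constant
`c = (4/π²)(C₅(R) − 1/R)`, see note 2 of `VinogradovKorobovIntermediateInputs.lean`), and the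
`N(jt, ½)` terms cancel against `−4D Σ b_j N(jt, ½)` since `C₅(R) − 1/R ≤ 1.0146` ((6.9),
corrected); (6.7) from `cot x − 1/x ≥ −0.3334x` (`x = π(1−β) ≤ π/1712`); `J(jt) ≤ J(Kt + 1)`,
`log(jt) ≤ L₁`, `log log(jt) ≤ L₂`. [cite: MossinghoffTrudgianYangRNT2024, Lemma 6.1 (proof: (6.2)–(6.9))]
[cite: Ford2002Millennium, §9 ((9.2) and the display after it)] -/
theorem mtyDetectorRHS_nonneg_from (Far : ℝ → ℝ → ℝ → Prop) {θ : ℝ}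
    (hθF : IsFordTheta (mtyB40 0) (mtyB40 1) θ) (hθ1 : 1.13331020 ≤ θ) (hθ2 : θ ≤ 1.13331021)
    (h42 : ∀ (f : ℝ → ℝ) (D : ℝ), IsFordSmoothing f (1 / 2) D →
      (∀ t : ℝ, 1000 ≤ t → ∀ S : ℝ, Far t (1 / 2) S → FordDetectorIneqRaw (1 / 2) f D t S) ∧
        (fordK f 1).re ≤ (fordLaplace f 0).re + 1.8 * D)
    (hP : zeta_half_line_patel)
    {T₉₂ : ℝ} (h92 : ∀ t : ℝ, T₉₂ ≤ t → Far t (1 / 2)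
      (3.2357 * Real.log t + 5.316 * Real.log (Real.log t) + 16.134 - 4 * fordN t (1 / 2)))
    {β t : ℝ} (ht : 10000 ≤ t) (ht92 : T₉₂ ≤ t) (hzero : riemannZeta (β + t * I) = 0)
    (hβ : 1 - 1 / 1712 ≤ β)
    {lam : ℝ} (hlam : 0 < lam) (hlam1 : lam ≤ 1 - β) (hrect : ZetaZeroFreeRect lam t (40 * t + 1)) :
    0 ≤ mtyDetectorRHS θ β t lam := by
  have hJ : ∀ t : ℝ, 100 ≤ t → 1 / 2 * fordLogZetaIntegral (1 / 2) t (1 / π) ≤ mtyJ t :=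
    fun t ht ↦ half_fordLogZetaIntegral_half_le_mtyJ hP ht
  have h32 := mty_threeHalves_line_bound_mtyB40
  have hπ := Real.pi_pos
  have hπ4 := Real.pi_lt_d2
  have hb0 : mtyB40 0 = 1 := mtyB40_zero
  have hθ := hθF.1
  have hθ' := hθF.2.1
  rw [hb0] at hθF
  have hK : FordKernelFacts θ := fordKernelFacts hθ hθ'
  have hb1 := mtyB40_one_ge
  have hbnn := isNonnegTrigPoly_mtyB40
  have hb1nn : 0 ≤ mtyB40 1 := hbnn.1 1
  have hβ1 : 0 < 1 - β := one_sub_pos_of_riemannZeta_eq_zero hzero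
  -- `R = 1/(2(1−β)) − 1 ≥ 855`
  set R : ℝ := 1 / (2 * (1 - β)) - 1 with hRdef
  have hR1 : R + 1 = 1 / (2 * (1 - β)) := by rw [hRdef]; ring
  have hR : 855 ≤ R := by
    have h1 : (856 : ℝ) ≤ 1 / (2 * (1 - β)) := by
      rw [le_div_iff₀ (by positivity)]; linarith
    linarith
  have hR3 : (3 : ℝ) ≤ R := by linarith
  have hR0 : 0 < R := by linarith
  have htan : Real.tan θ < R := (tan_fordTheta_lt_three hb1 hθF).trans_le hR3
  have hw0 : 0 < fordSmoothW0 θ := fordSmoothW0_pos hθ hθ'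
  have hw0k : fordKernelW θ 0 = fordSmoothW0 θ := fordKernelW_zero hθ hθ'
  have hf0 : fordSmoothF θ lam 0 = lam * fordSmoothW0 θ := by rw [fordSmoothF_zero, hw0k]
  have hf0pos : 0 < fordSmoothF θ lam 0 := by rw [hf0]; positivity
  have hC5 : fordC5 θ R ≤ 1.0117 := VK.fordC5_le_of_ge_855 hθ1 hθ2 hR
  have hc4 : 0 ≤ fordC5 θ R := by
    have := fordH_nonneg_of_pos hθ hθ' hR0
    unfold fordC5; positivity
  set D : ℝ := 1.0146 * lam * fordSmoothF θ lam 0 with hDdef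
  have hD0 : 0 ≤ D := by positivity
  -- `(R + 1)λ ≤ ½` and `λ ≤ (½)/(R + 1) = 1 − β`
  have hhalf : (1 / 2 : ℝ) / (R + 1) = 1 - β := by
    rw [hR1]; field_simp
  have hlam2 : lam ≤ (1 / 2 : ℝ) / (R + 1) := by rw [hhalf]; exact hlam1
  have hRl : (R + 1) * lam ≤ 1 / 2 := by
    have hR10 : 0 < R + 1 := by linarith
    rw [le_div_iff₀ hR10] at hlam2; linarith
  -- `f` is an admissible smoothing with `D = 1.0146 λ f(0)` from `η = ½` on
  have hfS : IsFordSmoothing (fordSmoothF θ lam) (1 / 2) D := by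
    refine ⟨contDiff_fordSmoothF hK.contDiff lam, fordSmoothF_nonneg hθ hθ' hlam,
      ⟨2 * (θ * Real.cot θ) / lam, fun u hu ↦ fordSmoothF_eq_zero hθ hθ' hlam hu⟩, fun z hz hzη ↦ ?_⟩
    have h := norm_fordLaplace_fordSmoothF_sub_le hθ hθ' hR3 htan hK.closed_form hw0k hw0 hlam hz
      (hRl.trans hzη)
    refine h.trans ?_
    rw [hDdef]
    have hz0 : 0 < ‖z‖ ^ 2 := by
      have : 0 < ‖z‖ := lt_of_lt_of_le (by norm_num) hzη
      positivity
    apply div_le_div_of_nonneg_right _ hz0.le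
    have : fordC5 θ R ≤ 1.0146 := hC5.trans (by norm_num)
    have h0 : 0 ≤ lam * fordSmoothF θ lam 0 := by positivity
    nlinarith
  -- the zero-free rectangle: zeros near `1 + i(j+1)t` have `Re ρ ≤ 1 − λ`
  have hzeros : ∀ j : ℕ, j < 40 → ∀ ρ ∈ fordNearZeros (((j : ℝ) + 1) * t) (1 / 2), ρ.re ≤ 1 - lam := by
    intro j hj ρ hρ
    rw [mem_fordNearZeros] at hρ
    by_contra hcon
    rw [not_le] at hcon
    have hre1 : ρ.re ≤ 1 := by
      by_contra h1
      exact riemannZeta_ne_zero_of_one_le_re (s := ρ) (not_le.1 h1).le hρ.1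
    have hj' : (j : ℝ) + 1 ≤ 40 := by
      have : (j : ℝ) ≤ 39 := by exact_mod_cast Nat.lt_succ_iff.1 hj
      linarith
    have hj0 : (0 : ℝ) ≤ j := j.cast_nonneg
    have him : |((j : ℝ) + 1) * t - ρ.im| ≤ 1 / 2 := by
      have h := Complex.abs_im_le_norm (1 + ((((j : ℝ) + 1) * t : ℝ) : ℂ) * I - ρ)
      have e : (1 + ((((j : ℝ) + 1) * t : ℝ) : ℂ) * I - ρ).im = ((j : ℝ) + 1) * t - ρ.im := by simp
      rw [e] at h
      exact h.trans hρ.2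
    rw [abs_le] at him
    have ht0 : 0 ≤ t := by linarith only [ht]
    have hjt : 0 ≤ (j : ℝ) * t := mul_nonneg hj0 ht0
    have hjt2 : ((j : ℝ) + 1) * t ≤ 40 * t := mul_le_mul_of_nonneg_right hj' ht0
    refine hrect ρ hcon hre1 ?_ ?_ hρ.1
    · nlinarith only [him.2, hjt, ht]
    · linarith only [him.1, hjt2]
  -- the far-zero bound and the detector at heights `(j+1)t`
  set Sf : ℝ → ℝ := fun τ ↦ 3.2357 * Real.log τ + 5.316 * Real.log (Real.log τ) + 16.134
    - 4 * fordN τ (1 / 2) with hSf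
  have hdet : ∀ j : ℕ, j < 40 →
      FordDetectorIneqRaw (1 / 2) (fordSmoothF θ lam) D (((j : ℝ) + 1) * t) (Sf (((j : ℝ) + 1) * t)) := by
    intro j hj
    have hj0 : (0 : ℝ) ≤ j := j.cast_nonneg
    have h1 : t ≤ ((j : ℝ) + 1) * t := le_mul_of_one_le_left (by linarith only [ht]) (by linarith only [hj0])
    have hτ : 10000 ≤ ((j : ℝ) + 1) * t := by linarith only [h1, ht]
    exact (h42 _ D hfS).1 _ (by linarith only [hτ]) _
      (h92 _ (by linarith only [h1, ht92]))
  have hK1 : (fordK (fordSmoothF θ lam) 1).re ≤ (fordLaplace (fordSmoothF θ lam) 0).re + 1.8 * D :=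
    (h42 _ D hfS).2
  -- `F(0) = W(-1)`
  have hF0 : (fordLaplace (fordSmoothF θ lam) 0).re = fordLaplaceW θ (-1) := by
    rw [fordLaplace_fordSmoothF hlam, zero_div, zero_sub, show (-1 : ℂ) = ((-1 : ℝ) : ℂ) by push_cast; ring,
      fordLaplaceWC_ofReal, Complex.ofReal_re]
  -- positivity (6.1)/(6.3)
  have hpos := fordK_trigPoly_nonneg' (fordSmoothF_nonneg hθ hθ' hlam)
    (fun u hu ↦ fordSmoothF_eq_zero hθ hθ' hlam hu) hbnn t
  rw [hb0] at hpos
  -- logs and `J`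
  have hL : ∀ j : ℕ, j < 40 → Real.log (((j : ℝ) + 1) * t) ≤ Real.log (40 * t + 1) ∧
      Real.log (Real.log (((j : ℝ) + 1) * t)) ≤ Real.log (Real.log (40 * t + 1)) :=
    fun j hj ↦ ⟨(mty_logs_le ht hj).2.1, (mty_logs_le ht hj).2.2⟩
  have hJmono : ∀ j : ℕ, j < 40 → mtyJ (((j : ℝ) + 1) * t) ≤ mtyJ (40 * t + 1) := by
    intro j hj
    unfold mtyJ
    linarith [(hL j hj).1]
  have hJj : ∀ j : ℕ, j < 40 →
      1 / 2 * fordLogZetaIntegral (1 / 2) (((j : ℝ) + 1) * t) (1 / π) ≤ mtyJ (((j : ℝ) + 1) * t) := by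
    intro j hj
    have hj0 : (0 : ℝ) ≤ j := j.cast_nonneg
    refine hJ _ ?_
    have h1 : t ≤ ((j : ℝ) + 1) * t := le_mul_of_one_le_left (by linarith only [ht]) (by linarith only [hj0])
    linarith only [h1, ht]
  -- summing the detector inequalities over `j`
  have hSK : ∑ j ∈ Finset.range 40, mtyB40 (j + 1) *
        (fordK (fordSmoothF θ lam) (1 + ((((j : ℝ) + 1) * t : ℝ) : ℂ) * I)).re
      ≤ mtyB40Sum * (fordSmoothF θ lam 0 * mtyJ (40 * t + 1)
          + D * (1.8 + Real.log (40 * t + 1) / 3 + 3.2357 * Real.log (40 * t + 1)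
            + 5.316 * Real.log (Real.log (40 * t + 1)) + 16.134))
        - ∑ j ∈ Finset.range 40, mtyB40 (j + 1) * fordNearSum (fordSmoothF θ lam) (1 / 2) (((j : ℝ) + 1) * t)
        - fordSmoothF θ lam 0 / 2 *
            ∑ j ∈ Finset.range 40, mtyB40 (j + 1) *
              fordLogZetaIntegral (3 / 2) (((j : ℝ) + 1) * t) (1 / π)
        - 4 * D * ∑ j ∈ Finset.range 40, mtyB40 (j + 1) * fordN (((j : ℝ) + 1) * t) (1 / 2) := by
    have hbSdef : ∑ j ∈ Finset.range 40, mtyB40 (j + 1) = mtyB40Sum := rfl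
    rw [Finset.mul_sum, Finset.mul_sum, ← hbSdef, Finset.sum_mul, ← Finset.sum_sub_distrib,
      ← Finset.sum_sub_distrib, ← Finset.sum_sub_distrib]
    refine Finset.sum_le_sum fun j hj ↦ ?_
    rw [Finset.mem_range] at hj
    have h := hdet j hj
    unfold FordDetectorIneqRaw at h
    rw [show (1 : ℝ) - 1 / 2 = 1 / 2 by norm_num, show (1 : ℝ) + 1 / 2 = 3 / 2 by norm_num,
      show (2 : ℝ) * (1 / 2) / π = 1 / π by ring, show (4 : ℝ) * (1 / 2) = 2 by norm_num] at h
    exact detector_step_half hf0pos.le hD0 (hbnn.1 _) (hL j hj).1 (hL j hj).2 (hJj j hj) (hJmono j hj) h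
  -- the `3/2`-line
  have hSI := h32 t
  rw [hb0] at hSI
  -- the near-zero sums
  set c : ℝ := π / (2 * (1 / 2)) * lam with hcdef
  set bd : ℝ := fordVBound θ R c with hbddef
  have hSNS : -(∑ j ∈ Finset.range 40, mtyB40 (j + 1) *
        fordNearSum (fordSmoothF θ lam) (1 / 2) (((j : ℝ) + 1) * t))
      ≤ -(mtyB40 1 * (fordV θ c (((π / (2 * (1 / 2)) * (1 - β) : ℝ)) : ℂ)).re)
        + bd * ∑ j ∈ Finset.range 40, mtyB40 (j + 1) * fordN (((j : ℝ) + 1) * t) (1 / 2) := by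
    -- the generic heights `(j+1)t`, `j ≥ 1`
    have hrest : -(∑ j ∈ Finset.range 39, mtyB40 (j + 1 + 1) *
          fordNearSum (fordSmoothF θ lam) (1 / 2) ((((j + 1 : ℕ) : ℝ) + 1) * t))
        ≤ bd * ∑ j ∈ Finset.range 39, mtyB40 (j + 1 + 1) * fordN ((((j + 1 : ℕ) : ℝ) + 1) * t) (1 / 2) := by
      rw [Finset.mul_sum, ← Finset.sum_neg_distrib]
      refine Finset.sum_le_sum fun j hj ↦ ?_
      rw [Finset.mem_range] at hj
      have hbj : 0 ≤ mtyB40 (j + 1 + 1) := hbnn.1 _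
      have h := neg_fordNearSum_le hθ hθ' hR3 htan hK hlam (by norm_num : (0 : ℝ) < 1 / 2) hlam2
        (hzeros (j + 1) (by omega))
      rw [← hcdef, ← hbddef] at h
      have h' := mul_le_mul_of_nonneg_left h hbj
      linarith only [h']
    -- the height `t` of the zero itself
    have hz0 : ∀ ρ ∈ fordNearZeros t (1 / 2), ρ.re ≤ 1 - lam := by
      have h0 := hzeros 0 (by norm_num)
      simp only [Nat.cast_zero, zero_add, one_mul] at h0
      exact h0
    have h0 := neg_fordNearSum_le_of_zero hθ hθ' hR3 htan hK hlam (by norm_num : (0 : ℝ) < 1 / 2)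
      hlam2 hzero (by linarith only [hβ]) hz0
    rw [← hcdef, ← hbddef] at h0
    have h0' := mul_le_mul_of_nonneg_left h0 hb1nn
    rw [Finset.sum_range_succ', Finset.sum_range_succ' (fun j ↦ mtyB40 (j + 1) * fordN (((j : ℝ) + 1) * t) (1 / 2))]
    simp only [Nat.cast_zero, zero_add, one_mul]
    linarith only [hrest, h0']
  -- the cancellation `c₅ c² w(0) ≤ 4D` ((6.9), corrected: `C₅(R) − 1/R ≤ 1.0146`)
  have hbd : bd ≤ 4 * D := by
    rw [hbddef, fordVBound, hDdef, hf0, hcdef]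
    have h1 : fordC5 θ R - 1 / R ≤ 1.0146 := by
      have : 0 < 1 / R := by positivity
      linarith only [hC5, this]
    have h2 : 0 ≤ lam ^ 2 * fordSmoothW0 θ := by positivity
    have h3 := mul_le_mul_of_nonneg_right h1 h2
    have e : 4 / π ^ 2 * (fordC5 θ R - 1 / R) * (π / (2 * (1 / 2)) * lam) ^ 2 * fordSmoothW0 θ
        = 4 * (fordC5 θ R - 1 / R) * (lam ^ 2 * fordSmoothW0 θ) := by
      have hπ0 : π ≠ 0 := hπ.ne'
      rw [show π / (2 * (1 / 2)) * lam = π * lam by ring, mul_pow,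
        show 4 / π ^ 2 * (fordC5 θ R - 1 / R) * (π ^ 2 * lam ^ 2) * fordSmoothW0 θ
          = (π ^ 2 / π ^ 2) * (4 * (fordC5 θ R - 1 / R) * (lam ^ 2 * fordSmoothW0 θ)) by ring,
        div_self (pow_ne_zero 2 hπ0), one_mul]
    rw [e]
    have e2 : 4 * (1.0146 * lam * (lam * fordSmoothW0 θ)) = 4 * 1.0146 * (lam ^ 2 * fordSmoothW0 θ) := by ring
    rw [e2]
    linarith only [h3]
  have hSN : 0 ≤ ∑ j ∈ Finset.range 40, mtyB40 (j + 1) * fordN (((j : ℝ) + 1) * t) (1 / 2) :=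
    Finset.sum_nonneg fun j _ ↦ mul_nonneg (hbnn.1 _) (fordN_nonneg _ _)
  -- the zero `β + it` itself: (6.7)
  have hx0 : 0 < π / (2 * (1 / 2)) * (1 - β) := by positivity
  have hx0' : π / (2 * (1 / 2)) * (1 - β) ≤ 1 / 20 := by
    have h1712 : 1 - β ≤ 1 / 1712 := by linarith only [hβ]
    calc π / (2 * (1 / 2)) * (1 - β) = π * (1 - β) := by ring
      _ ≤ 3.15 * (1 / 1712) := mul_le_mul hπ4.le h1712 hβ1.le (by norm_num)
      _ ≤ 1 / 20 := by norm_num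
  have hV0 : -(0.3334 * π ^ 2 * fordSmoothF θ lam 0 * (1 - β))
      + fordLaplaceW θ ((1 - β) / lam - 1)
      ≤ (fordV θ c (((π / (2 * (1 / 2)) * (1 - β) : ℝ)) : ℂ)).re := by
    have hcot := cot_sub_inv_ge_real_sharp hx0 hx0'
    have harg : (((π / (2 * (1 / 2)) * (1 - β) : ℝ) : ℂ)) / (c : ℂ) - 1 = (((1 - β) / lam - 1 : ℝ) : ℂ) := by
      rw [hcdef]; push_cast
      have : (lam : ℂ) ≠ 0 := by exact_mod_cast hlam.ne'
      have : (π : ℂ) ≠ 0 := by exact_mod_cast hπ.ne'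
      have : (2 : ℂ) ≠ 0 := by norm_num
      field_simp
    have hre : (fordV θ c (((π / (2 * (1 / 2)) * (1 - β) : ℝ)) : ℂ)).re
        = c * fordSmoothW0 θ * (Real.cot (π / (2 * (1 / 2)) * (1 - β)) - 1 / (π / (2 * (1 / 2)) * (1 - β)))
          + fordLaplaceW θ ((1 - β) / lam - 1) := by
      unfold fordV
      rw [harg, fordLaplaceWC_ofReal, Complex.add_re, ← Complex.ofReal_cot, ← Complex.ofReal_one,
        ← Complex.ofReal_div, ← Complex.ofReal_sub, ← Complex.ofReal_mul, Complex.ofReal_re,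
        Complex.ofReal_re]
    rw [hre, hf0, hcdef]
    have h1 := mul_le_mul_of_nonneg_left hcot (by positivity : 0 ≤ π / (2 * (1 / 2)) * lam * fordSmoothW0 θ)
    have e : π / (2 * (1 / 2)) * lam * fordSmoothW0 θ * (-0.3334 * (π / (2 * (1 / 2)) * (1 - β)))
        = -(0.3334 * π ^ 2 * (lam * fordSmoothW0 θ) * (1 - β)) := by
      ring
    linarith only [h1, e]
  -- assemble
  unfold mtyDetectorRHS
  rw [hw0k, hb0, ← hF0]
  exact assembly_half_final hf0 hDdef hb1nn hf0pos.le hpos hK1 hSK hSI hSNS hbd hSN hV0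


/-! ## Consequences: Lemma 6.1 (from any threshold `T ≥ 10⁴`), the named fact, and Theorem 1.4 as printed -/

/-- `10⁴ ≤ exp 999`. [folklore] -/
theorem VK.exp_999_ge : (10000 : ℝ) ≤ Real.exp 999 := by
  have h1 : Real.exp 14 ≤ Real.exp 999 := Real.exp_le_exp.2 (by norm_num)
  have h2 : Real.exp 14 = Real.exp 1 ^ 14 := by rw [← Real.exp_nat_mul]; norm_num
  have h3 : (2.7182818283 : ℝ) ^ 14 ≤ Real.exp 1 ^ 14 :=
    pow_le_pow_left₀ (by norm_num) Real.exp_one_gt_d9.le 14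
  have h4 : (10000 : ℝ) ≤ 2.7182818283 ^ 14 := by norm_num
  linarith

/-- **Lemma 6.1 of Mossinghoff–Trudgian–Yang from every threshold `T ≥ 10⁴`**
(`ZeroInequalityIntermediateFrom T`, also `T ≥ T₉₂`), from the printed analytic inputs of its
proof: MTY Lemma 4.2 at `η = ½` (`h42`, raw smoothed zero detector), Patel's sub-Weyl bound (3.3)
(`hP`, the tree's named fact `zeta_half_line_patel`) and the far-zero bound (6.4) (`h92`, from
`T₉₂` on) — MTY Lemma 4.3, the `3/2`-line bound and the kernel facts being theorems of the tree;
the angle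
`θ` of (4.1)–(4.2) is supplied by `VK.exists_isFordTheta_mtyB40` and the kernel layer (6.10)–(6.11)
by `zeroInequalityIntermediateFrom_of_detector`. (The source states Lemma 6.1 for
`t ≥ exp 1000`; its proof uses the height only through `t ≥ 10⁴`, Lemma 4.2 (`t ≥ 1000`) and
Lemma 4.3 (`t ≥ 100`).) [cite: MossinghoffTrudgianYangRNT2024, Lemma 6.1] -/
theorem zeroInequalityIntermediateFrom_of_ford (Far : ℝ → ℝ → ℝ → Prop)
    (h42 : ∀ (f : ℝ → ℝ) (D : ℝ), IsFordSmoothing f (1 / 2) D →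
      (∀ t : ℝ, 1000 ≤ t → ∀ S : ℝ, Far t (1 / 2) S → FordDetectorIneqRaw (1 / 2) f D t S) ∧
        (fordK f 1).re ≤ (fordLaplace f 0).re + 1.8 * D)
    (hP : zeta_half_line_patel)
    {T₉₂ : ℝ} (h92 : ∀ t : ℝ, T₉₂ ≤ t → Far t (1 / 2)
      (3.2357 * Real.log t + 5.316 * Real.log (Real.log t) + 16.134 - 4 * fordN t (1 / 2)))
    {T : ℝ} (hT : 10000 ≤ T) (hT92 : T₉₂ ≤ T) : ZeroInequalityIntermediateFrom T := by
  obtain ⟨θ, hθ, h1, h2⟩ := VK.exists_isFordTheta_mtyB40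
  refine zeroInequalityIntermediateFrom_of_detector hθ h1 h2 (by linarith) ?_
  intro β t ht hz hβ lam hl0 hl1 hrect
  exact mtyDetectorRHS_nonneg_from Far hθ h1 h2 h42 hP h92
    (hT.trans ht) (hT92.trans ht) hz hβ hl0 hl1 hrect

/-- **The named fact `zero_inequality_intermediate_mossinghoff_trudgian_yang` (Lemma 6.1 as
vendored, threshold `exp 1000`) from the printed analytic inputs of its proof** (see
`zeroInequalityIntermediateFrom_of_ford`). [cite: MossinghoffTrudgianYangRNT2024, Lemma 6.1] -/
theorem zero_inequality_intermediate_mossinghoff_trudgian_yang_of_ford (Far : ℝ → ℝ → ℝ → Prop)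
    (h42 : ∀ (f : ℝ → ℝ) (D : ℝ), IsFordSmoothing f (1 / 2) D →
      (∀ t : ℝ, 1000 ≤ t → ∀ S : ℝ, Far t (1 / 2) S → FordDetectorIneqRaw (1 / 2) f D t S) ∧
        (fordK f 1).re ≤ (fordLaplace f 0).re + 1.8 * D)
    (hP : zeta_half_line_patel)
    (h92 : ∀ t : ℝ, Real.exp 999 ≤ t → Far t (1 / 2)
      (3.2357 * Real.log t + 5.316 * Real.log (Real.log t) + 16.134 - 4 * fordN t (1 / 2))) :
    zero_inequality_intermediate_mossinghoff_trudgian_yang :=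
  zeroInequalityIntermediateFrom_exp_iff.1
    (zeroInequalityIntermediateFrom_of_ford Far h42 hP h92
      (VK.exp_999_ge.trans (Real.exp_le_exp.2 (by norm_num))) (Real.exp_le_exp.2 (by norm_num)))

/-- **Theorem 1.4 of Mossinghoff–Trudgian–Yang as printed — the named fact
`zero_free_region_intermediate_mossinghoff_trudgian_yang` (threshold `exp 1000`) — from the printed
analytic inputs of Lemma 6.1** (`h42`, Patel's (3.3), (6.4) = `h92` from `exp 999` on):
Lemma 6.1 holds from the threshold `exp 1000 − 770000`
(`zeroInequalityIntermediateFrom_of_ford`), which is what the in-tree descent of §6 consumes to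
reach the printed threshold (`zero_free_region_intermediate_mossinghoff_trudgian_yang_of_from`,
`VinogradovKorobovIntermediateThreshold.lean`; a-priori classical region from
`ZetaZeroFreeRegionExplicit.lean`, so neither Theorem 1.3 nor a verification of RH to any height is
involved). [cite: MossinghoffTrudgianYangRNT2024, Theorem 1.4 and §6] -/
theorem zero_free_region_intermediate_mossinghoff_trudgian_yang_of_ford (Far : ℝ → ℝ → ℝ → Prop)
    (h42 : ∀ (f : ℝ → ℝ) (D : ℝ), IsFordSmoothing f (1 / 2) D →
      (∀ t : ℝ, 1000 ≤ t → ∀ S : ℝ, Far t (1 / 2) S → FordDetectorIneqRaw (1 / 2) f D t S) ∧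
        (fordK f 1).re ≤ (fordLaplace f 0).re + 1.8 * D)
    (hP : zeta_half_line_patel)
    (h92 : ∀ t : ℝ, Real.exp 999 ≤ t → Far t (1 / 2)
      (3.2357 * Real.log t + 5.316 * Real.log (Real.log t) + 16.134 - 4 * fordN t (1 / 2))) :
    zero_free_region_intermediate_mossinghoff_trudgian_yang :=
  zero_free_region_intermediate_mossinghoff_trudgian_yang_of_from
    (zeroInequalityIntermediateFrom_of_ford Far h42 hP h92
      (by linarith [VK.exp_999_ge, VK.exp_1000_sub_ge]) (by linarith [VK.exp_1000_sub_ge]))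


/-! ## Ford's numerical constant, discharged for `VinogradovKorobovIntermediateDetector.lean` -/

/-- The double sum `Σ_p Σ_m log p/(p^m(p^m − 1))` of `VinogradovKorobovIntermediateDetector.lean`
is the sum `Σ_n Λ(n)/(n(n−1))` of `VinogradovKorobovThreeHalvesLine.lean`. [folklore] -/
theorem fordMangoldtSum_eq_fordLambdaSum : fordMangoldtSum = fordLambdaSum := by
  rw [fordMangoldtSum, ← hasSum_primes_fordLambdaTerm.tsum_eq]
  refine tsum_congr fun p ↦ tsum_congr fun m ↦ ?_
  rcases Nat.eq_zero_or_pos m with rfl | hm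
  · rw [FordThreeHalves.fordPrimeTerm_zero, pow_zero, fordLambdaTerm_one]
  · rw [fordLambdaTerm_prime_pow p hm.ne', fordPrimeTerm]

/-- **Ford's constant `Σ_p Σ_m log p/(p^m(p^m − 1)) ≤ 0.851`** — hypothesis `hΛ` of
`zero_inequality_intermediate_of_ford` (`VinogradovKorobovIntermediateDetector.lean`), discharged
by the certified numerics of `VinogradovKorobovThreeHalvesLine.lean`
(`FordLambda.fordLambdaSum_le`). [cite: Ford2002Millennium, §9 (first display)] -/
theorem fordMangoldtSum_le : fordMangoldtSum ≤ 0.851 := by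
  rw [fordMangoldtSum_eq_fordLambdaSum]
  exact FordLambda.fordLambdaSum_le

/-- **Lemma 6.1 (the named fact) from MTY Lemma 4.2 at `η = ½`, Patel's (3.3) and (6.4) only**:
`zero_inequality_intermediate_of_ford` of `VinogradovKorobovIntermediateDetector.lean` with its
numerical hypothesis `hΛ` discharged. [cite: MossinghoffTrudgianYangRNT2024, Lemma 6.1] -/
theorem zero_inequality_intermediate_of_ford_numerics
    (h42 : ∀ (f : ℝ → ℝ) (D : ℝ), IsFordSmoothing f (1 / 2) D →
      (∀ t : ℝ, 1000 ≤ t → ∀ S : ℝ, FordFarZeroSumLE t (1 / 2) S →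
        FordDetectorIneqRaw (1 / 2) f D t S) ∧
        (fordK f 1).re ≤ (fordLaplace f 0).re + 1.8 * D)
    (hP : zeta_half_line_patel)
    (h91 : ∀ τ : ℝ, 10000 ≤ τ → FordFarZeroSumLE τ (1 / 2)
      (3.2357 * Real.log τ + 5.316 * Real.log (Real.log τ) + 16.134 - 4 * fordN τ (1 / 2))) :
    zero_inequality_intermediate_mossinghoff_trudgian_yang :=
  zero_inequality_intermediate_of_ford h42 hP h91 fordMangoldtSum_le

/-- **Theorem 1.4 as printed from the hypotheses of `zero_inequality_intermediate_of_ford`**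
(`VinogradovKorobovIntermediateDetector.lean`: `h42` at `η = ½` with the tree's
`FordFarZeroSumLE`, Patel's fact, (6.4) = Ford (9.2) for `τ ≥ 10⁴`), the numerical constant being
discharged; the instance `Far := FordFarZeroSumLE` of
`zero_free_region_intermediate_mossinghoff_trudgian_yang_of_ford` (see the section on far sums for
why the instance `Far := FordFarZeroSumLT` is the one a Riemann–von Mangoldt formula can supply).
[cite: MossinghoffTrudgianYangRNT2024, Theorem 1.4 and §6] -/
theorem zero_free_region_intermediate_mossinghoff_trudgian_yang_of_ford_le
    (h42 : ∀ (f : ℝ → ℝ) (D : ℝ), IsFordSmoothing f (1 / 2) D →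
      (∀ t : ℝ, 1000 ≤ t → ∀ S : ℝ, FordFarZeroSumLE t (1 / 2) S →
        FordDetectorIneqRaw (1 / 2) f D t S) ∧
        (fordK f 1).re ≤ (fordLaplace f 0).re + 1.8 * D)
    (hP : zeta_half_line_patel)
    (h91 : ∀ τ : ℝ, 10000 ≤ τ → FordFarZeroSumLE τ (1 / 2)
      (3.2357 * Real.log τ + 5.316 * Real.log (Real.log τ) + 16.134 - 4 * fordN τ (1 / 2))) :
    zero_free_region_intermediate_mossinghoff_trudgian_yang :=
  zero_free_region_intermediate_mossinghoff_trudgian_yang_of_ford FordFarZeroSumLE h42 hP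
    fun t ht ↦ h91 t (VK.exp_999_ge.trans ht)

end Literature.NumberTheory.LFunctions
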